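import Literature.MathematicalPhysics.QuantumFieldTheory.ConformalBootstrap3D.PointKernelK34L505Data
import Literature.MathematicalPhysics.QuantumFieldTheory.ConformalBootstrap3D.PointKernelK34L505Segs
import Literature.MathematicalPhysics.QuantumFieldTheory.ConformalBootstrap3D.PointKernelParts

/-!
# K34L505 certificate, kernel part file P47: one-cell head segments 109, 110 in level ranges

The head cells whose kernel evaluation exceeds one `decide` are one-cell segments of `hsegsK34L505`; each is
checked by `PCert.hPartSideOK` (side conditions) and `PCert.hPartOK` per level range `[n_lo, n_lo + count)`
against an integer claim, the claims summing to `≥ 0` (`PointKernel.partsOK`); soundness is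
`PCert.hParts_sound` (`PointKernelParts`).  The part files are mutually independent (each imports only
the data file); the ranges of one cell may span several of them, and the per-cell conclusions
`hparts_i` / `hcell_i` of those cells are assembled in `PointKernelK34L505.lean`.
Estimated kernel time 236 s.
-/

set_option maxRecDepth 100000
set_option maxHeartbeats 0

namespace Literature.MathematicalPhysics.QuantumFieldTheory.ConformalBootstrap3D.PointKernelK34L505

open Literature.MathematicalPhysics.QuantumFieldTheory.ConformalBootstrap3D.PointKernel

/-- levels `[30, 43)` of segment 109: partial lower sum `≥` claim. [folklore] -/
theorem part_109_1 : certK34L505.hPartOK (PCert.segAt hsegsK34L505 109) JHK34L505 30 13 (13357808177171837254773020427416992131) = true := by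
  decide +kernel

/-- levels `[43, 52)` of segment 109: partial lower sum `≥` claim. [folklore] -/
theorem part_109_2 : certK34L505.hPartOK (PCert.segAt hsegsK34L505 109) JHK34L505 43 9 (2919021757098672918273827806087589805) = true := by
  decide +kernel

/-- levels `[52, 57)` of segment 109: partial lower sum `≥` claim. [folklore] -/
theorem part_109_3 : certK34L505.hPartOK (PCert.segAt hsegsK34L505 109) JHK34L505 52 5 (690264704958901580275340769757562323) = true := by
  decide +kernel

/-- one-cell segment 110 (row 6, cell `[1795/256, 3591/512]`, chord, `n_F = 56`,
4 level ranges): side conditions. [folklore] -/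
theorem pside_110 : certK34L505.hPartSideOK (PCert.segAt hsegsK34L505 110) JHK34L505 = true := by
  decide +kernel

/-- its level ranges `(n_lo, count, claim)`. [folklore] -/
def partsK34L505_110 : List (ℕ × ℕ × ℤ) := [(0, 30, -16509324059521602658768533186205705320), (30, 13, 13214913780822046343154301775777991338), (43, 9, 2762977529409124705532914737970414588), (52, 5, 531432749290431610081316672457299394)]

/-- the ranges tile `[0, n_F]` and the claims sum to `≥ 0`. [folklore] -/
theorem pcov_110 : PointKernel.partsOK 56 partsK34L505_110 = true := by
  decide +kernel

/-- levels `[0, 30)` of segment 110: partial lower sum `≥` claim. [folklore] -/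
theorem part_110_0 : certK34L505.hPartOK (PCert.segAt hsegsK34L505 110) JHK34L505 0 30 (-16509324059521602658768533186205705320) = true := by
  decide +kernel

end Literature.MathematicalPhysics.QuantumFieldTheory.ConformalBootstrap3D.PointKernelK34L505
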